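import Summits.NavierStokesRegularity.NavierStokesRegularity.Theorems.FilamentSkeletonRssSkeletonJ1RLineDefs
import Summits.NavierStokesRegularity.NavierStokesRegularity.Theorems.FilamentSkeletonRssSkeletonJ1RLiaDefectSelfBound
import Summits.NavierStokesRegularity.NavierStokesRegularity.Theorems.FilamentSkeletonRssSkeletonJ1RLiaDefectPartnerBound
import Summits.NavierStokesRegularity.NavierStokesRegularity.Theorems.FilamentSkeletonRssSkeletonJ1RLiaDefectSplit
import Summits.NavierStokesRegularity.NavierStokesRegularity.Theorems.FilamentSkeletonRssSkeletonJ1RLiaFrameExists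

/-!
# Route `FilamentSkeletonRss` · crux `SkeletonJ1R` (stmt-NavierStokesRegularity-23610) · STUB F2-B `stub_liaDefectBL` — THE DEFECT RATE OF THE LIA
# FRAME, RATE B: `‖swDefect(x) j τ‖ ≤ C_d (√Γ + |τ|)/√(log Γ)` (cancellation-free form of the registered F2 `LiaDefectL`)

Lead `ns-fsr-lead-23610` (g2), line `streamline_kantorovich_R` (skeleton of record v5).  `--supports stmt-NavierStokesRegularity-23610`.

THE THEOREM (`stub_liaDefectBL : LiaDefectBL`, statement in `…SkeletonJ1RLineDefs` §4): for every general-position straight datum there is `Rb₁ > 0`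
such that for every `0 < Rb ≤ Rb₁` there are `Γ₁, C_d` with, for all `Γ ≥ Γ₁` and every datum-sliced frame `(x, M)` at `λ = 1` whose reference is THE
local-induction reference, `‖swDefect(x) j τ‖ ≤ C_d (√Γ + |τ|)/√(log Γ)` for all `j, τ`.  Assembly of the lead's F2 chain: the split (A1
`IsLiaReference.norm_swDefect_le`) into the self-strand local-induction error (B1 `selfTerm_bound`, from S1–S4, E1–E2) and the partners'
ambient-vs-actual mismatches (B2 `partnerTerm_bound`, from P1–P2, G); off the switched region the defect vanishes, on it `|τ| ≤ 3ℓ`.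
RATE B versus the registered RATE A (`log log Γ/log Γ`, `LiaDefectL`): RATE A additionally needs the oddness of the reference's S-bend (two
cancellation lemmas, lead g0's F2-notes / lead g2's NOTES); RATE B is what the Kantorovich closing consumes (`KantorovichClosingBL`, LineDefs §4:
first Newton step `O(Rb³√Γ)` inside the fine tolerance, `h ≍ Rb²/√log Γ → 0`).
HONEST FRAMING: MODEL rung, NEGATIVE side of the ladder — a theorem about the explicit LIA reference frame of a HYPOTHETICAL filament-type
rotating-self-similar blow-up skeleton; the crux 23610, its heart 23320 and 23612 stay OPEN; nothing here proves, refutes or moves any statement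
about Navier–Stokes regularity. [folklore]
-/

-- `dupNamespace` off: the module name repeats `NavierStokesRegularity` by the tree's `Summits/<S>/<S>/Theorems` layout (same as every sibling file).
set_option linter.dupNamespace false

noncomputable section

namespace Summit.NavierStokesRegularity.NavierStokesRegularity.Theorems.SkeletonJ1RFrame

open Set Function Filter Real Topology MeasureTheory
open Literature.Analysis.FluidPDE
open Summit.NavierStokesRegularity.NavierStokesRegularity.Theorems.SkeletonJ1RDefectTools (swDefect_ref_eq_zero_of_switchWeight_eq_zero)
open Summit.NavierStokesRegularity.NavierStokesRegularity.Theorems.SkeletonJ1RSlipTools (chord_arc_of_osc)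
open scoped InnerProductSpace BigOperators

/-- In the switched region the parameter is at most `3ℓ`: if the switch weight at `x_j τ` is nonzero (so `‖x_j τ‖ < √2 ℓ`), the reference has tilt
`≤ Rb/8 ≤ 1/10`, `‖q_j‖ ≤ Rwd` and `12 Rwd/Rb ≤ √log Γ`, then `|τ| ≤ 3Rb√Γ√log Γ`. [folklore] -/
theorem abs_param_le_of_switchWeight_ne_zero {N : ℕ} {Γ Rb Rwd : ℝ} {p t : Fin N → EuclideanSpace ℝ (Fin 3)} {γ : Fin N → ℝ} {α : ℝ}
    {s₀ : Fin N → ℝ} {x : Fin N → ℝ → EuclideanSpace ℝ (Fin 3)} (hx : IsLiaReference Γ Rb p t γ α s₀ x) (hΓ : 1 < Γ) (hRb : 0 < Rb)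
    (hRb1 : Rb ≤ 4 / 5) (j : Fin N) (htilt : ∀ σ, ‖deriv (x j) σ - t j‖ ≤ Rb / 8) (hq : ‖p j + s₀ j • t j‖ ≤ Rwd)
    (hL : 12 * Rwd / Rb ≤ Real.sqrt (Real.log Γ)) {τ : ℝ}
    (hw : switchWeight (Rb * Real.sqrt (Γ * Real.log Γ)) 1 (x j τ) ≠ 0) :
    |τ| ≤ 3 * Rb * Real.sqrt Γ * Real.sqrt (Real.log Γ) := by
  obtain ⟨hC2, hunit, h0, -, -⟩ := hx j
  have hΓ0 : 0 < Γ := by linarith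
  have hlog0 : 0 < Real.log Γ := Real.log_pos hΓ
  set G := Real.sqrt Γ with hG
  set sL := Real.sqrt (Real.log Γ) with hsL
  have hG0 : 0 < G := Real.sqrt_pos.2 hΓ0
  have hsL0 : 0 < sL := Real.sqrt_pos.2 hlog0
  set ℓ := Rb * Real.sqrt (Γ * Real.log Γ) with hℓ
  have hℓeq : ℓ = Rb * G * sL := by rw [hℓ, Real.sqrt_mul hΓ0.le, mul_assoc]
  have hℓ0 : 0 < ℓ := by rw [hℓeq]; positivity
  -- ‖x_j τ‖ < √2 ℓ ≤ (17/12) ℓ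
  have hy : ‖x j τ‖ ^ 2 < 2 * ℓ ^ 2 := by
    by_contra h
    push Not at h
    exact hw (switchWeight_eq_zero_of_le_sq hℓ0.ne' (by linarith))
  have hy' : ‖x j τ‖ ≤ 17 / 12 * ℓ := by
    nlinarith [norm_nonneg (x j τ), hℓ0]
  -- chord–arc: |τ|/2 ≤ ‖x_j τ − w_j‖
  have hosc : ∀ u v, ‖deriv (x j) u - deriv (x j) v‖ ≤ Rb / 4 := fun u v => by
    calc ‖deriv (x j) u - deriv (x j) v‖ = ‖(deriv (x j) u - t j) - (deriv (x j) v - t j)‖ := by congr 1; abel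
      _ ≤ ‖deriv (x j) u - t j‖ + ‖deriv (x j) v - t j‖ := norm_sub_le _ _
      _ ≤ Rb / 4 := by linarith [htilt u, htilt v]
  have hch := chord_arc_of_osc (hC2.of_le (by norm_num)) hunit hosc τ 0
  rw [sub_zero, h0] at hch
  have hhalf : |τ| / 2 ≤ ‖x j τ - waistPt Γ p t s₀ j‖ := by
    have : (1 / 2 : ℝ) * |τ| ≤ (1 - (Rb / 4) ^ 2 / 2) * |τ| := mul_le_mul_of_nonneg_right (by nlinarith) (abs_nonneg τ)
    linarith
  have hw' : ‖waistPt Γ p t s₀ j‖ ≤ Rwd * G := by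
    rw [waistPt_eq, norm_smul, Real.norm_of_nonneg hG0.le, mul_comm]; exact mul_le_mul_of_nonneg_right hq hG0.le
  have htri : ‖x j τ - waistPt Γ p t s₀ j‖ ≤ ‖x j τ‖ + ‖waistPt Γ p t s₀ j‖ := norm_sub_le _ _
  -- 2Rwd G ≤ Rb G sL/6
  have hRw : 2 * (Rwd * G) ≤ ℓ / 6 := by
    rw [hℓeq]
    have h1 : 12 * Rwd ≤ Rb * sL := by rw [div_le_iff₀ hRb] at hL; linarith
    nlinarith [hG0]
  calc |τ| ≤ 2 * ‖x j τ - waistPt Γ p t s₀ j‖ := by linarith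
    _ ≤ 2 * (17 / 12 * ℓ) + 2 * (Rwd * G) := by linarith
    _ ≤ 3 * ℓ := by linarith
    _ = 3 * Rb * Real.sqrt Γ * Real.sqrt (Real.log Γ) := by rw [hℓeq]; ring

/-- **STUB F2-B · `stub_liaDefectBL`** — the defect rate of the LIA frame, RATE B (see the module docstring). [folklore] -/
theorem stub_liaDefectBL : LiaDefectBL := by
  intro N δd ρd Λd Rwd θd mw p t γ α s₀ hN hδ hρ hRw hθ hmw hSD hGP
  obtain ⟨ht, hsep, -, hparams, hq, -⟩ := hSD
  -- general position with θg = min θd 1 ∈ (0, 1]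
  set θg := min θd 1 with hθg
  have hθg0 : 0 < θg := lt_min hθ one_pos
  have hθg1 : θg ≤ 1 := min_le_right _ _
  have hGP' : ∀ j k, j ≠ k → |inner ℝ (t j) (t k)| ≤ 1 - θg := fun j k hjk =>
    (hGP j k hjk).trans (by linarith [min_le_left θd 1])
  -- parameter bounds from the datum
  have hγlo : ∀ k, θd ≤ |γ k| := fun k => (hparams.2.2 k).1
  have hγhi : ∀ k, |γ k| ≤ θd⁻¹ := fun k => (hparams.2.2 k).2
  have hα : |α| ≤ θd⁻¹ := hparams.2.1
  -- Lipschitz constant of the smooth transition, tilt budget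
  obtain ⟨C, hC0, hC⟩ := exists_smoothTransition_lipschitz
  obtain ⟨θ₁, hθ₁0, hθ₁h, hθ₁A⟩ := tiltBudget_exists θg ρd (fun j => p j + s₀ j • t j) hθg0 hρ
  -- the tolerance ceiling
  set cst : ℝ := min (ρd / 4) (3 * ρd * Real.sqrt θg / (16 * (2 * Rwd + ρd / 2))) with hcst
  have hcst0 : 0 < cst := by
    have := Real.sqrt_pos.2 hθg0
    exact lt_min (by positivity) (by positivity)
  set Rb₁ : ℝ := min (4 * θ₁) (min (4 / 5) (4 * cst / (5 * (2 * Rwd + 1)))) with hRb₁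
  have hRb₁0 : 0 < Rb₁ := lt_min (by positivity) (lt_min (by norm_num) (by positivity))
  refine ⟨Rb₁, hRb₁0, fun Rb hRb hRbR => ?_⟩
  have hRbθ : Rb / 8 ≤ θ₁ := by have : Rb ≤ 4 * θ₁ := hRbR.trans (min_le_left _ _); linarith
  have hRb45 : Rb ≤ 4 / 5 := hRbR.trans ((min_le_right _ _).trans (min_le_left _ _))
  have hRbg : Rb ≤ 4 * cst / (5 * (2 * Rwd + 1)) := hRbR.trans ((min_le_right _ _).trans (min_le_right _ _))
  -- the two Γ-bookkeeping bricks
  obtain ⟨Cself, Ls, hCself0, hself⟩ := selfTerm_bound N hθ hρ hRw.le hRb hC0 hC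
  obtain ⟨Cpart, Lp, hCpart0, hpart⟩ := partnerTerm_bound N hθ hθg0 hθg1 hρ hRw.le hRb hRb45 hRbg
  set Mx : ℝ := max (max Ls Lp) (max ((12 * Rwd / Rb) ^ 2) 1) with hMx
  refine ⟨Real.exp Mx, Cself + N * Cpart, fun Γ hΓ x M hx hSF j τ => ?_⟩
  -- Γ-level facts
  have hΓe : Real.exp 1 ≤ Γ := (Real.exp_le_exp.2 ((le_max_right _ _).trans (le_max_right _ _))).trans hΓ
  have hΓ1 : 1 < Γ := lt_of_lt_of_le (by have := Real.add_one_lt_exp (one_ne_zero (α := ℝ)); linarith) hΓe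
  have hΓ0 : 0 < Γ := by linarith
  have hlog : Mx ≤ Real.log Γ := (Real.le_log_iff_exp_le hΓ0).2 hΓ
  have hLs : Ls ≤ Real.log Γ := ((le_max_left _ _).trans (le_max_left _ _)).trans hlog
  have hLp : Lp ≤ Real.log Γ := ((le_max_right _ _).trans (le_max_left _ _)).trans hlog
  have hlog1 : 1 ≤ Real.log Γ := ((le_max_right _ _).trans (le_max_right _ _)).trans hlog
  have hlog0 : 0 < Real.log Γ := by linarith
  have hsL : 12 * Rwd / Rb ≤ Real.sqrt (Real.log Γ) := by
    have h : (12 * Rwd / Rb) ^ 2 ≤ Real.log Γ := ((le_max_left _ _).trans (le_max_right _ _)).trans hlog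
    have := Real.sqrt_le_sqrt h
    rwa [Real.sqrt_sq (by positivity)] at this
  have hℓ : Rb * Real.sqrt (Γ * Real.log Γ) ≠ 0 := by
    have : 0 < Real.sqrt (Γ * Real.log Γ) := Real.sqrt_pos.2 (by positivity); positivity
  obtain ⟨hSR, hSM⟩ := hSF
  obtain ⟨-, htilt, -, -⟩ := hSR
  have hρΓ : 0 ≤ ρd * Real.sqrt Γ := by positivity
  have hβ : liaCoeff Γ γ j ≠ 0 := by
    unfold liaCoeff
    have hγj : γ j ≠ 0 := fun h => by have := hγlo j; rw [h, abs_zero] at this; linarith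
    exact div_ne_zero (mul_ne_zero (mul_ne_zero hΓ0.ne' hγj) hlog0.ne') (by positivity)
  have hRHS0 : 0 ≤ (Cself + N * Cpart) * (Real.sqrt Γ + |τ|) / Real.sqrt (Real.log Γ) := by positivity
  -- off the switched region the defect vanishes
  by_cases hw : switchWeight (Rb * Real.sqrt (Γ * Real.log Γ)) 1 (x j τ) = 0
  · rw [swDefect_ref_eq_zero_of_switchWeight_eq_zero hSM hρΓ (fun k σ => (hx k).2.1 σ) j τ hw, norm_zero]
    exact hRHS0
  -- on it, |τ| ≤ 3ℓ and the split applies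
  have hτ : |τ| ≤ 3 * Rb * Real.sqrt Γ * Real.sqrt (Real.log Γ) :=
    abs_param_le_of_switchWeight_ne_zero hx hΓ1 hRb hRb45 j (htilt j) (hq j) hsL hw
  have hsplit := hx.norm_swDefect_le hSM hρΓ hℓ j hβ τ
  have h1 := hself hΓ1 hLs hx ht hθg0 hθg1 hGP' hsep j hθ₁0.le hθ₁h (fun k _ => hθ₁A j k) (htilt j) hRbθ (hγlo j) hγhi hα hq hτ
  have h2 : ∀ k ∈ Finset.univ.erase j, ‖(Γ * γ k / (4 * Real.pi)) • ((∫ σ : ℝ, ((‖x j τ - x k σ‖ ^ 2 +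
          Real.exp (-(1+Real.eulerMascheroniConstant-Real.log 2)) * (1:ℝ)) ^ (3 / 2 : ℝ))⁻¹ • cross (deriv (x k) σ) (x j τ - x k σ)) -
        ∫ σ : ℝ, ((‖x j τ - datumLine Γ p t s₀ k σ‖ ^ 2 +
          Real.exp (-(1+Real.eulerMascheroniConstant-Real.log 2)) * (1:ℝ)) ^ (3 / 2 : ℝ))⁻¹ • cross (t k) (x j τ - datumLine Γ p t s₀ k σ))‖ ≤
      Cpart * (Real.sqrt Γ + |τ|) / Real.sqrt (Real.log Γ) := fun k hk =>
    hpart hΓ1 hLp hx ht hGP' hsep hθ₁0.le (fun j k _ => hθ₁A j k) htilt hRbθ hγlo hγhi hα hq j k (Finset.ne_of_mem_erase hk) hτ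
  have hsum := Finset.sum_le_sum h2
  rw [Finset.sum_const, nsmul_eq_mul] at hsum
  have hcard : ((Finset.univ.erase j).card : ℝ) ≤ N := by
    rw [Finset.card_erase_of_mem (Finset.mem_univ j), Finset.card_univ, Fintype.card_fin]; exact_mod_cast Nat.sub_le N 1
  have hpos : 0 ≤ Cpart * (Real.sqrt Γ + |τ|) / Real.sqrt (Real.log Γ) := by positivity
  have hsum' := hsum.trans (mul_le_mul_of_nonneg_right hcard hpos)
  calc ‖swDefect Γ Rb γ α M x j τ‖ ≤ _ := hsplit
    _ ≤ Cself * (Real.sqrt Γ + |τ|) / Real.sqrt (Real.log Γ) + N * (Cpart * (Real.sqrt Γ + |τ|) / Real.sqrt (Real.log Γ)) :=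
        add_le_add h1 hsum'
    _ = (Cself + N * Cpart) * (Real.sqrt Γ + |τ|) / Real.sqrt (Real.log Γ) := by ring

end Summit.NavierStokesRegularity.NavierStokesRegularity.Theorems.SkeletonJ1RFrame

end
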